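import Mathlib
import Summits.NavierStokesRegularity.NavierStokesRegularity.Theorems.SubcriticalEnvelopeForwardSourceSmoothingFlux
import HarnessLib

/-!
# `SubcriticalEnvelope.ForwardSourceSmoothing` (stmt-NavierStokesRegularity-26374, crux B⁺) — stage β:
per-shell energy estimates for the non-source modes (helper file, `--supports`)

For a regular solution `X` of the `ν`-viscous cascade lattice on a window `[0,s]` and a mode set
`S` containing the forward sources, the `D`-ENERGY of shell `k`, `y_k(t) = Σ_{d ∉ S} ½X_{d,k}(t)²`,
satisfies `y_k' = Φ^D_k − 2ν(1+ε₀)^{2k} y_k` (`forwardSourceSmoothing_hasDerivWithinAt_denergy`)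
with the flux `Φ^D_k` of stage α.  Feeding the flux bound `forwardSourceSmoothing_abs_flux_le` with
source-amplitude bounds `p₀ ≥ p₁, p₋` (shells `k, k+1, k−1`) and an energy bound `Λ'` for the
non-source modes of shell `k+1` gives the pointwise differential inequalities
(`forwardSourceSmoothing_flux_le_linear`)
* growth form   `y' ≤ (r+1)·y + c²/2`,
* dissipative form `y' ≤ −ν(1+ε₀)^{2k}·y + c²/(ν(1+ε₀)^{2k})` once `r ≤ ν(1+ε₀)^{2k}/2`,
with `r = 4m³M_α(1+ε₀)^{5k/2}p₀`, `c = m³M_α(4(1+ε₀)^{5k/2}p₀² + 2(1+ε₀)^{5k/2}p₀√(2Λ') +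
(1+ε₀)^{5(k−1)/2}p₋²)`, and hence, by Grönwall (`Mathlib`'s `gronwallBound`), the two per-shell
bounds `forwardSourceSmoothing_shell_growth` (`y_k(t) ≤ (y_k(0) + c²s/2)·e^{(r+1)s}`) and
`forwardSourceSmoothing_shell_dissipative` (`y_k(t) ≤ y_k(0) + c²/(ν²(1+ε₀)^{4k})`).  The second is
the slaving estimate: beyond the crossover shell the non-source energy is quadratically small in the
source envelope, up to the catalysed exchange with the shell above (the `√Λ'` term).

HONEST FRAMING: estimates for Tao-type MODEL lattice ODEs (Tao 2016 §4; Barbato–Morandin–Romito 2011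
§3 type dissipation bootstrap); nothing here bears on the Navier–Stokes equations; no summit is proved.
-/

noncomputable section

-- the sub-problem namespace `NavierStokesRegularity.NavierStokesRegularity` is the tree's layout (D-0017)
set_option linter.dupNamespace false

namespace Summit.NavierStokesRegularity.NavierStokesRegularity.Theorems

open Set Finset
open Literature.Analysis.FluidPDE.TaoCascade

variable {m : ℕ}

/-! ## Grönwall bookkeeping -/

/-- `gronwallBound` with a NEGATIVE rate: `δe^{-κx} + (ε/κ)(1 − e^{-κx}) ≤ δ + ε/κ`
(`δ, ε, x ≥ 0`, `κ > 0`). [folklore] -/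
theorem forwardSourceSmoothing_gronwallBound_neg_le {δ κ ε x : ℝ} (hδ : 0 ≤ δ) (hκ : 0 < κ)
    (hε : 0 ≤ ε) (hx : 0 ≤ x) : gronwallBound δ (-κ) ε x ≤ δ + ε / κ := by
  rw [gronwallBound_of_K_ne_0 (neg_ne_zero.2 hκ.ne')]
  simp only
  have hκx : 0 ≤ κ * x := mul_nonneg hκ.le hx
  have h1 : Real.exp (-κ * x) ≤ 1 := Real.exp_le_one_iff.2 (by linarith)
  have h0 : 0 < Real.exp (-κ * x) := Real.exp_pos _
  have h2 : ε / -κ * (Real.exp (-κ * x) - 1) = ε / κ * (1 - Real.exp (-κ * x)) := by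
    rw [div_neg]; ring
  rw [h2]
  have h3 : ε / κ * (1 - Real.exp (-κ * x)) ≤ ε / κ := by
    have : 0 ≤ ε / κ := div_nonneg hε hκ.le
    nlinarith
  nlinarith

/-- `gronwallBound` with a POSITIVE rate: `δe^{Kx} + (ε/K)(e^{Kx} − 1) ≤ (δ + εx)e^{Kx}`
(`ε ≥ 0`, `K > 0`; uses `e^{Kx} − 1 ≤ Kx·e^{Kx}`, any real `x`). [folklore] -/
theorem forwardSourceSmoothing_gronwallBound_pos_le {δ K ε x : ℝ} (hK : 0 < K) (hε : 0 ≤ ε) :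
    gronwallBound δ K ε x ≤ (δ + ε * x) * Real.exp (K * x) := by
  rw [gronwallBound_of_K_ne_0 hK.ne']
  simp only
  -- `e^{Kx} - 1 ≤ Kx e^{Kx}` from `1 - Kx ≤ e^{-Kx}`
  have h1 : Real.exp (K * x) - 1 ≤ K * x * Real.exp (K * x) := by
    have h := Real.add_one_le_exp (-(K * x))
    have hE : Real.exp (-(K * x)) * Real.exp (K * x) = 1 := by
      rw [← Real.exp_add, neg_add_cancel, Real.exp_zero]
    nlinarith [Real.exp_pos (K * x), Real.exp_pos (-(K * x))]
  have h2 : ε / K * (Real.exp (K * x) - 1) ≤ ε * x * Real.exp (K * x) := by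
    calc ε / K * (Real.exp (K * x) - 1) ≤ ε / K * (K * x * Real.exp (K * x)) :=
          mul_le_mul_of_nonneg_left h1 (div_nonneg hε hK.le)
      _ = ε * x * Real.exp (K * x) := by field_simp
  nlinarith

/-- **Scalar Grönwall on a window, from a one-sided within-`[0,s]` derivative bound.** If `y` is
continuous on `[0,s]`, has derivative `y'(t)` within `[0,s]` at every `t ∈ [0,s]`, and
`y'(t) ≤ K·y(t) + ε` there, then `y(t) ≤ gronwallBound (y 0) K ε t` on `[0,s]`.
[cite: Teschl2012, §2.4 (Grönwall); Mathlib `le_gronwallBound_of_liminf_deriv_right_le`] -/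
theorem forwardSourceSmoothing_le_gronwallBound {y y' : ℝ → ℝ} {s K ε : ℝ}
    (hc : ContinuousOn y (Icc 0 s)) (hd : ∀ t ∈ Icc 0 s, HasDerivWithinAt y (y' t) (Icc 0 s) t)
    (hb : ∀ t ∈ Icc 0 s, y' t ≤ K * y t + ε) : ∀ t ∈ Icc 0 s, y t ≤ gronwallBound (y 0) K ε t := by
  have hd' : ∀ u ∈ Ico 0 s, HasDerivWithinAt y (y' u) (Ici u) u := fun u hu =>
    (hd u (Ico_subset_Icc_self hu)).mono_of_mem_nhdsWithin
      (Filter.mem_of_superset (Icc_mem_nhdsGE hu.2) (Icc_subset_Icc hu.1 le_rfl))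
  intro t ht
  have h := le_gronwallBound_of_liminf_deriv_right_le hc
    (fun u hu r hr => (hd' u hu).liminf_right_slope_le hr) le_rfl
    (fun u hu => hb u (Ico_subset_Icc_self hu)) t ht
  simpa using h

/-! ## The `D`-energy of one shell and its derivative -/

/-- **Energy identity for the non-source modes of shell `k`.** Along a solution of the `ν`-viscous
lattice within `[0,s]`, `y(τ) = Σ_{d∈D} ½X_{d,k}(τ)²` has derivative
`Σ_{d∈D} X_{d,k}·quadTerm_{d,k}(X) − 2ν(1+ε₀)^{2k}·y` within `[0,s]`. [cite: Tao2016AveragedNS, §4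
(4.8)–(4.9) (exact viscous form)] -/
theorem forwardSourceSmoothing_hasDerivWithinAt_denergy {ε₀ ν s : ℝ}
    {α : Fin m → Fin m → Fin m → ℤ × ℤ × ℤ → ℝ} {X : Fin m → ℤ → ℝ → ℝ} (D : Finset (Fin m))
    (k : ℤ) (hder : ∀ i, ∀ t ∈ Icc (0 : ℝ) s, HasDerivWithinAt (X i k)
      (quadTerm ε₀ α X i k t - ν * (1 + ε₀) ^ ((2 : ℝ) * k) * X i k t) (Icc 0 s) t)
    {t : ℝ} (ht : t ∈ Icc (0 : ℝ) s) :
    HasDerivWithinAt (fun τ => ∑ d ∈ D, (1 / 2 : ℝ) * X d k τ ^ 2)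
      (∑ d ∈ D, X d k t * quadTerm ε₀ α X d k t -
        2 * (ν * (1 + ε₀) ^ ((2 : ℝ) * k)) * ∑ d ∈ D, (1 / 2 : ℝ) * X d k t ^ 2) (Icc 0 s) t := by
  have hsum := HasDerivWithinAt.fun_sum (u := D)
    (A := fun d τ => (1 / 2 : ℝ) * X d k τ ^ 2)
    (A' := fun d => X d k t * (quadTerm ε₀ α X d k t - ν * (1 + ε₀) ^ ((2 : ℝ) * k) * X d k t))
    (x := t) (s := Icc 0 s) (fun d _ => by
      have h := ((hder d t ht).pow 2).const_mul (1 / 2 : ℝ)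
      refine h.congr_deriv ?_
      simp only [Nat.cast_ofNat]
      ring)
  refine hsum.congr_deriv ?_
  rw [Finset.mul_sum, ← Finset.sum_sub_distrib]
  exact Finset.sum_congr rfl fun d _ => by ring

/-- The `D`-energy of a shell is continuous. [folklore] -/
theorem forwardSourceSmoothing_continuous_denergy {X : Fin m → ℤ → ℝ → ℝ} (D : Finset (Fin m))
    (k : ℤ) (hcont : ∀ i, Continuous (X i k)) :
    Continuous (fun τ => ∑ d ∈ D, (1 / 2 : ℝ) * X d k τ ^ 2) :=
  continuous_finsetSum D fun d _ => ((hcont d).pow 2).const_mul _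

/-- A member of a sum of halves of squares is controlled by the sum: `|x_d| ≤ √(2y)`. [folklore] -/
theorem forwardSourceSmoothing_abs_le_sqrt_two_mul {D : Finset (Fin m)} {x : Fin m → ℝ} {y : ℝ}
    (hy : ∑ d ∈ D, (1 / 2 : ℝ) * x d ^ 2 ≤ y) {d : Fin m} (hd : d ∈ D) : |x d| ≤ Real.sqrt (2 * y) := by
  refine Real.abs_le_sqrt ?_
  have h : (1 / 2 : ℝ) * x d ^ 2 ≤ y :=
    (Finset.single_le_sum (f := fun d => (1 / 2 : ℝ) * x d ^ 2) (fun i _ => by positivity) hd).trans hy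
  linarith

/-! ## From the flux bound to linear differential inequalities -/

/-- **The flux in linear-plus-forcing form.** Under the hypotheses of
`forwardSourceSmoothing_abs_flux_le` with source bounds `p₁ ≤ p₀`, `p₋` and the non-source bounds
taken from the energies (`q₀ = √(2y)`, `y = Σ_{d∉S} ½X_{d,k}(t)²`; `q₁ = √(2Λ')` from an energy
bound `Λ'` on shell `k+1`): with `L = m³M_α`, `P = (1+ε₀)^{5k/2}`, `Q = (1+ε₀)^{5(k−1)/2}`,
`r = 4LPp₀`, `c = L(4Pp₀² + 2Pp₀√(2Λ') + Qp₋²)`, the flux obeys `Φ^D_k ≤ r·y + c·√(2y)`.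
[cite: Tao2016AveragedNS, §4 (4.2)–(4.3), (4.8)] -/
theorem forwardSourceSmoothing_flux_le_linear {ε₀ Mα p₀ p₁ pm Λ' : ℝ} (hε : 0 ≤ 1 + ε₀)
    (hMα : 0 ≤ Mα) {α : Fin m → Fin m → Fin m → ℤ × ℤ × ℤ → ℝ} (hs : IsSymmetricCoeff α)
    (hc : IsCancellingCoeff α) (hα : ∀ i₁ i₂ i₃ μ, μ ∈ shiftSet → |α i₁ i₂ i₃ μ| ≤ Mα)
    (S : Finset (Fin m)) (hS : ∀ i, i ∉ S → ∀ j l : Fin m, α i j l (0, 0, 1) = 0)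
    (X : Fin m → ℤ → ℝ → ℝ) (k : ℤ) (t : ℝ)
    (hp₀ : 0 ≤ p₀) (hp₁ : 0 ≤ p₁) (hpm : 0 ≤ pm) (h10 : p₁ ≤ p₀)
    (hS0 : ∀ i ∈ S, |X i k t| ≤ p₀) (hS1 : ∀ i ∈ S, |X i (k + 1) t| ≤ p₁)
    (hSm : ∀ i ∈ S, |X i (k - 1) t| ≤ pm)
    (hD1 : ∑ d ∈ Sᶜ, (1 / 2 : ℝ) * X d (k + 1) t ^ 2 ≤ Λ') :
    ∑ d ∈ Sᶜ, X d k t * quadTerm ε₀ α X d k t ≤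
      4 * ((m : ℝ) ^ 3 * Mα) * (1 + ε₀) ^ ((5 : ℝ) * k / 2) * p₀ *
          (∑ d ∈ Sᶜ, (1 / 2 : ℝ) * X d k t ^ 2) +
        ((m : ℝ) ^ 3 * Mα) * (4 * (1 + ε₀) ^ ((5 : ℝ) * k / 2) * p₀ ^ 2 +
            2 * (1 + ε₀) ^ ((5 : ℝ) * k / 2) * p₀ * Real.sqrt (2 * Λ') +
            (1 + ε₀) ^ ((5 : ℝ) * ((k : ℝ) - 1) / 2) * pm ^ 2) *
          Real.sqrt (2 * ∑ d ∈ Sᶜ, (1 / 2 : ℝ) * X d k t ^ 2) := by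
  have hy0 : 0 ≤ ∑ d ∈ Sᶜ, (1 / 2 : ℝ) * X d k t ^ 2 := Finset.sum_nonneg fun d _ => by positivity
  have hq₀ : 0 ≤ Real.sqrt (2 * ∑ d ∈ Sᶜ, (1 / 2 : ℝ) * X d k t ^ 2) := Real.sqrt_nonneg _
  have hq₁ : 0 ≤ Real.sqrt (2 * Λ') := Real.sqrt_nonneg _
  have hD0 : ∀ i, i ∉ S → |X i k t| ≤ Real.sqrt (2 * ∑ d ∈ Sᶜ, (1 / 2 : ℝ) * X d k t ^ 2) :=
    fun i hi => forwardSourceSmoothing_abs_le_sqrt_two_mul (x := fun j => X j k t) le_rfl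
      (Finset.mem_compl.2 hi)
  have hD1' : ∀ i, i ∉ S → |X i (k + 1) t| ≤ Real.sqrt (2 * Λ') := fun i hi =>
    forwardSourceSmoothing_abs_le_sqrt_two_mul (x := fun j => X j (k + 1) t) hD1
      (Finset.mem_compl.2 hi)
  have hΦ := forwardSourceSmoothing_abs_flux_le hε hMα hs hc hα S hS X k t hp₀ hq₀ hp₁ hq₁ hpm
    hS0 hD0 hS1 hD1' hSm
  have hP : 0 ≤ (1 + ε₀) ^ ((5 : ℝ) * k / 2) := Real.rpow_nonneg hε _
  have hL : 0 ≤ (m : ℝ) ^ 3 * Mα := by positivity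
  have hsq : Real.sqrt (2 * ∑ d ∈ Sᶜ, (1 / 2 : ℝ) * X d k t ^ 2) *
      Real.sqrt (2 * ∑ d ∈ Sᶜ, (1 / 2 : ℝ) * X d k t ^ 2) = 2 * ∑ d ∈ Sᶜ, (1 / 2 : ℝ) * X d k t ^ 2 :=
    Real.mul_self_sqrt (by linarith)
  -- `q₀ (p₀ + q₀ + p₁ + q₁) ≤ q₀ (2p₀ + q₁) + 2y`
  have key : 2 * (1 + ε₀) ^ ((5 : ℝ) * k / 2) * p₀ *
        Real.sqrt (2 * ∑ d ∈ Sᶜ, (1 / 2 : ℝ) * X d k t ^ 2) *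
        (p₀ + Real.sqrt (2 * ∑ d ∈ Sᶜ, (1 / 2 : ℝ) * X d k t ^ 2) + p₁ + Real.sqrt (2 * Λ')) ≤
      4 * (1 + ε₀) ^ ((5 : ℝ) * k / 2) * p₀ * (∑ d ∈ Sᶜ, (1 / 2 : ℝ) * X d k t ^ 2) +
        (4 * (1 + ε₀) ^ ((5 : ℝ) * k / 2) * p₀ ^ 2 +
          2 * (1 + ε₀) ^ ((5 : ℝ) * k / 2) * p₀ * Real.sqrt (2 * Λ')) *
          Real.sqrt (2 * ∑ d ∈ Sᶜ, (1 / 2 : ℝ) * X d k t ^ 2) := by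
    set Aq : ℝ := (1 + ε₀) ^ ((5 : ℝ) * k / 2) * p₀ *
        Real.sqrt (2 * ∑ d ∈ Sᶜ, (1 / 2 : ℝ) * X d k t ^ 2) with hAq
    have hPp : 0 ≤ Aq := by positivity
    have hmono : Aq * p₁ ≤ Aq * p₀ := mul_le_mul_of_nonneg_left h10 hPp
    have e1 : 2 * (1 + ε₀) ^ ((5 : ℝ) * k / 2) * p₀ *
          Real.sqrt (2 * ∑ d ∈ Sᶜ, (1 / 2 : ℝ) * X d k t ^ 2) *
          (p₀ + Real.sqrt (2 * ∑ d ∈ Sᶜ, (1 / 2 : ℝ) * X d k t ^ 2) + p₁ + Real.sqrt (2 * Λ')) =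
        2 * (Aq * p₀) + 2 * (Aq * p₁) + 2 * (Aq * Real.sqrt (2 * Λ')) +
          2 * ((1 + ε₀) ^ ((5 : ℝ) * k / 2) * p₀) *
            (Real.sqrt (2 * ∑ d ∈ Sᶜ, (1 / 2 : ℝ) * X d k t ^ 2) *
              Real.sqrt (2 * ∑ d ∈ Sᶜ, (1 / 2 : ℝ) * X d k t ^ 2)) := by
      rw [hAq]; ring
    have e2 : 4 * (1 + ε₀) ^ ((5 : ℝ) * k / 2) * p₀ * (∑ d ∈ Sᶜ, (1 / 2 : ℝ) * X d k t ^ 2) +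
        (4 * (1 + ε₀) ^ ((5 : ℝ) * k / 2) * p₀ ^ 2 +
          2 * (1 + ε₀) ^ ((5 : ℝ) * k / 2) * p₀ * Real.sqrt (2 * Λ')) *
          Real.sqrt (2 * ∑ d ∈ Sᶜ, (1 / 2 : ℝ) * X d k t ^ 2) =
        2 * ((1 + ε₀) ^ ((5 : ℝ) * k / 2) * p₀) * (2 * ∑ d ∈ Sᶜ, (1 / 2 : ℝ) * X d k t ^ 2) +
          4 * (Aq * p₀) + 2 * (Aq * Real.sqrt (2 * Λ')) := by
      rw [hAq]; ring
    rw [e1, e2, hsq]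
    linarith
  calc ∑ d ∈ Sᶜ, X d k t * quadTerm ε₀ α X d k t
      ≤ |∑ d ∈ Sᶜ, X d k t * quadTerm ε₀ α X d k t| := le_abs_self _
    _ ≤ _ := hΦ
    _ ≤ (m : ℝ) ^ 3 * Mα * (4 * (1 + ε₀) ^ ((5 : ℝ) * k / 2) * p₀ *
          (∑ d ∈ Sᶜ, (1 / 2 : ℝ) * X d k t ^ 2) +
        (4 * (1 + ε₀) ^ ((5 : ℝ) * k / 2) * p₀ ^ 2 +
          2 * (1 + ε₀) ^ ((5 : ℝ) * k / 2) * p₀ * Real.sqrt (2 * Λ')) *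
          Real.sqrt (2 * ∑ d ∈ Sᶜ, (1 / 2 : ℝ) * X d k t ^ 2) +
        (1 + ε₀) ^ ((5 : ℝ) * ((k : ℝ) - 1) / 2) * pm ^ 2 *
          Real.sqrt (2 * ∑ d ∈ Sᶜ, (1 / 2 : ℝ) * X d k t ^ 2)) :=
        mul_le_mul_of_nonneg_left (by linarith [key]) hL
    _ = _ := by ring

/-- AM–GM in the form used to absorb the forcing: `c·√(2y) ≤ λ·y + c²/(2λ)` (`λ > 0`, `y ≥ 0`).
[folklore] -/
theorem forwardSourceSmoothing_mul_sqrt_le {c y lam : ℝ} (hy : 0 ≤ y) (hlam : 0 < lam) :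
    c * Real.sqrt (2 * y) ≤ lam * y + c ^ 2 / (2 * lam) := by
  have hs : Real.sqrt (2 * y) ^ 2 = 2 * y := Real.sq_sqrt (by linarith)
  have h : 0 ≤ (lam * Real.sqrt (2 * y) - c) ^ 2 := sq_nonneg _
  have h2 : c * Real.sqrt (2 * y) * (2 * lam) ≤ (lam * y + c ^ 2 / (2 * lam)) * (2 * lam) := by
    have : (lam * y + c ^ 2 / (2 * lam)) * (2 * lam) = 2 * lam ^ 2 * y + c ^ 2 := by
      rw [add_mul, div_mul_cancel₀ _ (by positivity : (2 : ℝ) * lam ≠ 0)]; ring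
    rw [this]
    nlinarith [hs]
  exact le_of_mul_le_mul_right h2 (by linarith)

/-! ## The two per-shell bounds -/

/-- **Growth regime (any shell).** Let `X` solve the `ν`-viscous lattice within `[0,s]` with
continuous modes; on `[0,s]` let the sources obey `|X_{i,k}| ≤ p₀`, `|X_{i,k+1}| ≤ p₁ ≤ p₀`,
`|X_{i,k−1}| ≤ p₋` (`i ∈ S`) and the non-source energy of shell `k+1` be `≤ Λ'`.  Then with `r, c`
as in `forwardSourceSmoothing_flux_le_linear` the non-source energy of shell `k` obeys
`y_k(t) ≤ (y_k(0) + (c²/2)·s)·e^{(r+1)s}` on `[0,s]` (Grönwall; the dissipation is dropped).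
[cite: Tao2016AveragedNS, §4 (4.8)–(4.9); Teschl2012, §2.4] -/
theorem forwardSourceSmoothing_shell_growth {ε₀ ν Mα p₀ p₁ pm Λ' s : ℝ} (hε : 0 ≤ 1 + ε₀)
    (hMα : 0 ≤ Mα) {α : Fin m → Fin m → Fin m → ℤ × ℤ × ℤ → ℝ} (hs : IsSymmetricCoeff α)
    (hc : IsCancellingCoeff α) (hα : ∀ i₁ i₂ i₃ μ, μ ∈ shiftSet → |α i₁ i₂ i₃ μ| ≤ Mα)
    (S : Finset (Fin m)) (hS : ∀ i, i ∉ S → ∀ j l : Fin m, α i j l (0, 0, 1) = 0)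
    {X : Fin m → ℤ → ℝ → ℝ} (k : ℤ) (hν : 0 ≤ ν) (hcont : ∀ i k, Continuous (X i k))
    (hder : ∀ i k, ∀ t ∈ Icc (0 : ℝ) s, HasDerivWithinAt (X i k)
      (quadTerm ε₀ α X i k t - ν * (1 + ε₀) ^ ((2 : ℝ) * k) * X i k t) (Icc 0 s) t)
    (hp₀ : 0 ≤ p₀) (hp₁ : 0 ≤ p₁) (hpm : 0 ≤ pm) (h10 : p₁ ≤ p₀)
    (hS0 : ∀ t ∈ Icc (0 : ℝ) s, ∀ i ∈ S, |X i k t| ≤ p₀)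
    (hS1 : ∀ t ∈ Icc (0 : ℝ) s, ∀ i ∈ S, |X i (k + 1) t| ≤ p₁)
    (hSm : ∀ t ∈ Icc (0 : ℝ) s, ∀ i ∈ S, |X i (k - 1) t| ≤ pm)
    (hD1 : ∀ t ∈ Icc (0 : ℝ) s, ∑ d ∈ Sᶜ, (1 / 2 : ℝ) * X d (k + 1) t ^ 2 ≤ Λ') :
    ∀ t ∈ Icc (0 : ℝ) s, ∑ d ∈ Sᶜ, (1 / 2 : ℝ) * X d k t ^ 2 ≤
      (∑ d ∈ Sᶜ, (1 / 2 : ℝ) * X d k 0 ^ 2 +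
        ((m : ℝ) ^ 3 * Mα * (4 * (1 + ε₀) ^ ((5 : ℝ) * k / 2) * p₀ ^ 2 +
            2 * (1 + ε₀) ^ ((5 : ℝ) * k / 2) * p₀ * Real.sqrt (2 * Λ') +
            (1 + ε₀) ^ ((5 : ℝ) * ((k : ℝ) - 1) / 2) * pm ^ 2)) ^ 2 / 2 * s) *
      Real.exp ((4 * ((m : ℝ) ^ 3 * Mα) * (1 + ε₀) ^ ((5 : ℝ) * k / 2) * p₀ + 1) * s) := by
  intro t ht
  set r : ℝ := 4 * ((m : ℝ) ^ 3 * Mα) * (1 + ε₀) ^ ((5 : ℝ) * k / 2) * p₀ with hr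
  set c : ℝ := (m : ℝ) ^ 3 * Mα * (4 * (1 + ε₀) ^ ((5 : ℝ) * k / 2) * p₀ ^ 2 +
    2 * (1 + ε₀) ^ ((5 : ℝ) * k / 2) * p₀ * Real.sqrt (2 * Λ') +
    (1 + ε₀) ^ ((5 : ℝ) * ((k : ℝ) - 1) / 2) * pm ^ 2) with hcdef
  have hr0 : 0 ≤ r := by positivity
  have hy0 : ∀ τ, 0 ≤ ∑ d ∈ Sᶜ, (1 / 2 : ℝ) * X d k τ ^ 2 := fun τ =>
    Finset.sum_nonneg fun d _ => by positivity
  -- the differential inequality `y' ≤ (r+1) y + c²/2`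
  have hineq : ∀ τ ∈ Icc (0 : ℝ) s,
      ∑ d ∈ Sᶜ, X d k τ * quadTerm ε₀ α X d k τ -
        2 * (ν * (1 + ε₀) ^ ((2 : ℝ) * k)) * ∑ d ∈ Sᶜ, (1 / 2 : ℝ) * X d k τ ^ 2 ≤
      (r + 1) * (∑ d ∈ Sᶜ, (1 / 2 : ℝ) * X d k τ ^ 2) + c ^ 2 / 2 := by
    intro τ hτ
    have h1 := forwardSourceSmoothing_flux_le_linear hε hMα hs hc hα S hS X k τ hp₀ hp₁ hpm h10
      (hS0 τ hτ) (hS1 τ hτ) (hSm τ hτ) (hD1 τ hτ)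
    have h2 := forwardSourceSmoothing_mul_sqrt_le (c := c) (hy0 τ) one_pos
    have h3 : 0 ≤ 2 * (ν * (1 + ε₀) ^ ((2 : ℝ) * k)) * ∑ d ∈ Sᶜ, (1 / 2 : ℝ) * X d k τ ^ 2 :=
      mul_nonneg (mul_nonneg two_pos.le (mul_nonneg hν (Real.rpow_nonneg hε _))) (hy0 τ)
    rw [← hr, ← hcdef] at h1
    have h4 : c ^ 2 / (2 * 1) = c ^ 2 / 2 := by norm_num
    rw [h4, one_mul] at h2
    linarith
  have hG := forwardSourceSmoothing_le_gronwallBound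
    (forwardSourceSmoothing_continuous_denergy Sᶜ k (fun i => hcont i k)).continuousOn
    (fun τ hτ => forwardSourceSmoothing_hasDerivWithinAt_denergy Sᶜ k (fun i => hder i k) hτ)
    hineq t ht
  have hc2 : (0 : ℝ) ≤ c ^ 2 / 2 := div_nonneg (sq_nonneg c) two_pos.le
  have hr1 : (0 : ℝ) < r + 1 := by linarith
  refine hG.trans ((forwardSourceSmoothing_gronwallBound_pos_le hr1 hc2).trans ?_)
  have hE : Real.exp ((r + 1) * t) ≤ Real.exp ((r + 1) * s) :=
    Real.exp_le_exp.2 (mul_le_mul_of_nonneg_left ht.2 hr1.le)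
  have hy00 : 0 ≤ ∑ d ∈ Sᶜ, (1 / 2 : ℝ) * X d k 0 ^ 2 := hy0 0
  have hA : ∑ d ∈ Sᶜ, (1 / 2 : ℝ) * X d k 0 ^ 2 + c ^ 2 / 2 * t ≤
      ∑ d ∈ Sᶜ, (1 / 2 : ℝ) * X d k 0 ^ 2 + c ^ 2 / 2 * s := by
    have := mul_le_mul_of_nonneg_left ht.2 hc2
    linarith
  exact mul_le_mul hA hE (Real.exp_pos _).le (by nlinarith [mul_nonneg hc2 (ht.1.trans ht.2)])

/-- **Dissipative regime (shells beyond the crossover).** Same setting; if moreover the linear rate is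
dominated by half the dissipation, `4m³M_α(1+ε₀)^{5k/2}p₀ ≤ ν(1+ε₀)^{2k}/2` (`ν > 0`), then
`y_k(t) ≤ y_k(0) + c²/(ν²(1+ε₀)^{4k})` on `[0,s]`: the forcing is divided by the dissipation
(`y' ≤ −ν(1+ε₀)^{2k}y + c²/(ν(1+ε₀)^{2k})`, Grönwall with negative rate).  This is the slaving step.
[cite: BarbatoMorandinRomito2011, §3.1 Prop. 3.3 and §3.2; Tao2016AveragedNS, §4 (4.8)–(4.9)] -/
theorem forwardSourceSmoothing_shell_dissipative {ε₀ ν Mα p₀ p₁ pm Λ' s : ℝ} (hε : 0 < 1 + ε₀)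
    (hMα : 0 ≤ Mα) {α : Fin m → Fin m → Fin m → ℤ × ℤ × ℤ → ℝ} (hs : IsSymmetricCoeff α)
    (hc : IsCancellingCoeff α) (hα : ∀ i₁ i₂ i₃ μ, μ ∈ shiftSet → |α i₁ i₂ i₃ μ| ≤ Mα)
    (S : Finset (Fin m)) (hS : ∀ i, i ∉ S → ∀ j l : Fin m, α i j l (0, 0, 1) = 0)
    {X : Fin m → ℤ → ℝ → ℝ} (k : ℤ) (hν : 0 < ν) (hcont : ∀ i k, Continuous (X i k))
    (hder : ∀ i k, ∀ t ∈ Icc (0 : ℝ) s, HasDerivWithinAt (X i k)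
      (quadTerm ε₀ α X i k t - ν * (1 + ε₀) ^ ((2 : ℝ) * k) * X i k t) (Icc 0 s) t)
    (hp₀ : 0 ≤ p₀) (hp₁ : 0 ≤ p₁) (hpm : 0 ≤ pm) (h10 : p₁ ≤ p₀)
    (hS0 : ∀ t ∈ Icc (0 : ℝ) s, ∀ i ∈ S, |X i k t| ≤ p₀)
    (hS1 : ∀ t ∈ Icc (0 : ℝ) s, ∀ i ∈ S, |X i (k + 1) t| ≤ p₁)
    (hSm : ∀ t ∈ Icc (0 : ℝ) s, ∀ i ∈ S, |X i (k - 1) t| ≤ pm)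
    (hD1 : ∀ t ∈ Icc (0 : ℝ) s, ∑ d ∈ Sᶜ, (1 / 2 : ℝ) * X d (k + 1) t ^ 2 ≤ Λ')
    (hdom : 4 * ((m : ℝ) ^ 3 * Mα) * (1 + ε₀) ^ ((5 : ℝ) * k / 2) * p₀ ≤
      ν * (1 + ε₀) ^ ((2 : ℝ) * k) / 2) :
    ∀ t ∈ Icc (0 : ℝ) s, ∑ d ∈ Sᶜ, (1 / 2 : ℝ) * X d k t ^ 2 ≤
      ∑ d ∈ Sᶜ, (1 / 2 : ℝ) * X d k 0 ^ 2 +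
        ((m : ℝ) ^ 3 * Mα * (4 * (1 + ε₀) ^ ((5 : ℝ) * k / 2) * p₀ ^ 2 +
            2 * (1 + ε₀) ^ ((5 : ℝ) * k / 2) * p₀ * Real.sqrt (2 * Λ') +
            (1 + ε₀) ^ ((5 : ℝ) * ((k : ℝ) - 1) / 2) * pm ^ 2)) ^ 2 /
          (ν ^ 2 * (1 + ε₀) ^ ((4 : ℝ) * k)) := by
  intro t ht
  set κ : ℝ := ν * (1 + ε₀) ^ ((2 : ℝ) * k) with hκ
  have hκ0 : 0 < κ := mul_pos hν (Real.rpow_pos_of_pos hε _)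
  set c : ℝ := (m : ℝ) ^ 3 * Mα * (4 * (1 + ε₀) ^ ((5 : ℝ) * k / 2) * p₀ ^ 2 +
    2 * (1 + ε₀) ^ ((5 : ℝ) * k / 2) * p₀ * Real.sqrt (2 * Λ') +
    (1 + ε₀) ^ ((5 : ℝ) * ((k : ℝ) - 1) / 2) * pm ^ 2) with hcdef
  have hy0 : ∀ τ, 0 ≤ ∑ d ∈ Sᶜ, (1 / 2 : ℝ) * X d k τ ^ 2 := fun τ =>
    Finset.sum_nonneg fun d _ => by positivity
  -- the differential inequality `y' ≤ -κ y + c²/κ`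
  have hineq : ∀ τ ∈ Icc (0 : ℝ) s,
      ∑ d ∈ Sᶜ, X d k τ * quadTerm ε₀ α X d k τ -
        2 * (ν * (1 + ε₀) ^ ((2 : ℝ) * k)) * ∑ d ∈ Sᶜ, (1 / 2 : ℝ) * X d k τ ^ 2 ≤
      (-κ) * (∑ d ∈ Sᶜ, (1 / 2 : ℝ) * X d k τ ^ 2) + c ^ 2 / κ := by
    intro τ hτ
    have h1 := forwardSourceSmoothing_flux_le_linear hε.le hMα hs hc hα S hS X k τ hp₀ hp₁ hpm
      h10 (hS0 τ hτ) (hS1 τ hτ) (hSm τ hτ) (hD1 τ hτ)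
    have h2 := forwardSourceSmoothing_mul_sqrt_le (c := c) (hy0 τ) (half_pos hκ0)
    rw [← hcdef] at h1
    have h4 : c ^ 2 / (2 * (κ / 2)) = c ^ 2 / κ := by rw [mul_div_cancel₀ _ two_ne_zero]
    rw [h4] at h2
    rw [← hκ]
    have h5 : 4 * ((m : ℝ) ^ 3 * Mα) * (1 + ε₀) ^ ((5 : ℝ) * k / 2) * p₀ *
        (∑ d ∈ Sᶜ, (1 / 2 : ℝ) * X d k τ ^ 2) ≤ κ / 2 * (∑ d ∈ Sᶜ, (1 / 2 : ℝ) * X d k τ ^ 2) :=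
      mul_le_mul_of_nonneg_right hdom (hy0 τ)
    linarith
  have hG := forwardSourceSmoothing_le_gronwallBound
    (forwardSourceSmoothing_continuous_denergy Sᶜ k (fun i => hcont i k)).continuousOn
    (fun τ hτ => forwardSourceSmoothing_hasDerivWithinAt_denergy Sᶜ k (fun i => hder i k) hτ)
    hineq t ht
  refine hG.trans ((forwardSourceSmoothing_gronwallBound_neg_le (hy0 0) hκ0 (by positivity)
    ht.1).trans (le_of_eq ?_))
  rw [hκ, div_div]
  congr 1
  rw [show ((4 : ℝ) * k) = (2 : ℝ) * k + (2 : ℝ) * k by ring, Real.rpow_add hε]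
  ring

end Summit.NavierStokesRegularity.NavierStokesRegularity.Theorems

end
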